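import Summits.BirchSwinnertonDyer.Rank1Residual.AdditivePotMult.TwistSupply
import Summits.BirchSwinnertonDyer.Rank1Residual.X11b.CastellaErratumTwist
import HarnessLib

/-!
# X4(M) ∧ (ram): the rank-zero (ram) `p`-multiplicative twist EXISTS — `BSD(E,p)` from the
# over-`K` input over quadratic fields, uniformly on X4(M) ∩ (ram)

HONEST FRAMING (cell `b2b-bsdres`, run/shared/lean/b2b/bsd-rank1-residual/, verbatim in every
file): the goal of the cell is to DELETE the COMBINATION-SHAPED residual classes of the
Birch–Swinnerton-Dyer formula for ALL analytic-rank `≤ 1` elliptic curves over `ℚ` — "full BSD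
formula for every rank `≤ 1` curve in class `C`" assembled STRICTLY from published theorems — so
that the rank-`≤ 1` remainder becomes exactly the CONSTRUCTION-SHAPED classes, which are TYPED
(missing-input `Prop`s), NOT attempted. This is not "finishing BSD". Sub-cell
`b2b-bsdres-additive-p1` (CLASS-OWNERS row "X3/X4 additive — pot. multiplicative / X3♯(M)"),
generation 3; research route, no claim beyond the stated sub-classes; X4(M) REMAINS
CONSTRUCTION-SHAPED.

Theorems only; no definition, no new named fact. Generations 0–2 proved: for `(E,p) ∈ X4(M)` (odd
additive prime `p`, `E[p]` irreducible, `ord_p j(E) < 0`) and a quadratic field `K` whose twist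
`E^{(d_K)}` is `p`-multiplicative with `L(E^{(d_K)},1) ≠ 0` and (ram), `BSD(E,p)` follows from the
typed over-`K` input `MissingPPartOverCAt (W.baseChange K) p` ALONE
(`bsdp_of_classX4M_of_rankZero_twist'`; Skinner 2016 Thm. C closes the twist), with such `K` found
for 1683 ‖ 398 of the 1754 ‖ 418 census pairs (REPORT §6.5). Here the ANALYTIC half of the datum
(`L(E^{(d_K)},1) ≠ 0`) is removed; what remains is the ALGEBRAIC, decidable condition (ram) on `E` —

* `exists_quadraticField_model` — bookkeeping: a model of `E^{(e)}` not isomorphic to `E` is a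
  model of `E^{(d_K)}` for the quadratic field `K = ℚ(√e)`.
* `exists_mul_isSquare_padic_not_dvd` — a `q`-adic adjustment `x` of a twisting parameter `m`
  (`p ∤ x`, `m x` a square in `ℚ_q`; any prime `q ≠ p`, Hensel at `q` resp. mod `8` at `q = 2`).
* `bsdp_of_classX4M_of_mult_ram_twist` — let `(E,p) ∈ X4(M)` have analytic rank `≤ 1` and let `W₁`
  be a globally minimal model of SOME quadratic twist `E^{(d₀)}` which is multiplicative at `p` and
  has a multiplicative prime `q ≠ p` with `p ∤ v_q(Δ_min(W₁))` ((ram) for `W₁`). Then `BSD(E,p)`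
  follows from the over-`K` input granted over every quadratic field `K` whose twist `E^{(d_K)}` is
  `p`-multiplicative (Skinner 2016 Thm. C, Milne 1972 any-model, GZK, modularity, Hoffstein–Luo
  1997 as binders). Proof: the twist supply (`exists_twist_L_ne_zero_of_sign`) with `n ≡ 1 (mod 8)`
  and `(n/q) = 1` gives `n`, `p ∤ n`, `L(W₁^{(n)},1) ≠ 0`; `n` is a `q`-adic square, so
  multiplicative reduction at `q` and `v_q(Δ_min)` transport to the globally minimal model of
  `W₁^{(n)}` (x11b's `mult_iff_of_twist`, `padicValInt_minimalDiscriminantInt_eq_of_twist`), as does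
  multiplicative reduction at `p` (X2 owner's lemma).
* **`bsdp_of_classX4M_of_ram`** — the datum discharged when `E` ITSELF satisfies (ram)
  (`Ram W p`: a multiplicative prime `q ≠ p` with `p ∤ v_q(Δ_min(E))`): the `p`-multiplicative
  twisting parameter is adjusted `q`-adically so that `W₁` inherits `q` from `E`. So on
  **X4(M) ∩ (ram)** — a decidable sub-class; census 1673 ‖ 398 of the 1754 ‖ 418 X4(M) pairs with
  `N < 2·10⁴ ‖ 10⁴` — `BSD(E,p) ⇐` the over-`K` input over quadratic fields, uniformly, with no
  per-pair datum; `bsdp_of_classX4M_of_ram_of_forall_quadratic`, `missingPPartAt_of_classX4M_of_ram`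
  are the plain-hypothesis and Partition-currency forms.

What is NOT covered here (located remainder, census-level as before): X4(M) pairs failing (ram) on
`E` whose only (ram)-capable primes `q` are additive potentially multiplicative for `E`
(`v_q(j) < 0`, `p ∤ v_q(j)`; 10 ‖ 0 census pairs — there `d₀` must also be ramified at `q`, a
two-prime square-class approximation, not formalised), and the structural complement with no
(ram)-capable prime at all (71 ‖ 20 pairs: over-`K` input + X11a input of the twist, REPORT §6.5).
-/

noncomputable section

open scoped Classical

open WeierstrassCurve Literature.NumberTheory.EllipticCurves
  Literature.NumberTheory.EllipticCurves.ModularForms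
  Literature.NumberTheory.EllipticCurves.Rank1Residual
  Literature.NumberTheory.EllipticCurves.Rank1Residual.Typed
  IsDedekindDomain

namespace Summit.BirchSwinnertonDyer.Rank1Residual.AdditivePotMult

variable {W : WeierstrassCurve ℚ} [W.IsElliptic] {p : ℕ} [Fact p.Prime]

/-! ### §1 Bookkeeping: the quadratic field of a twist; a `q`-adic adjustment of the parameter -/

variable (W) in
omit [W.IsElliptic] in
/-- **The quadratic field of a twist.** If `Wd` is a `ℚ`-model of `E^{(e)}` (`e ∈ ℚ^×`) which is NOT
a `ℚ`-model of `E` itself, then `Wd` is a model of `E^{(d_K)}` for a quadratic field `K` (namely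
`K = ℚ(√e)`: write `e = c² t` with `t` a square-free integer, `t ≠ 1`, and `d_K ∈ {t, 4t}`).
[folklore] -/
theorem exists_quadraticField_model {e : ℚ} (he : e ≠ 0) {Wd : WeierstrassCurve ℚ}
    (hWd : ∃ C : VariableChange ℚ, C • W.quadraticTwist e = Wd)
    (hne : ¬ ∃ C : VariableChange ℚ, C • W = Wd) :
    ∃ (K : Type) (_ : Field K) (_ : NumberField K), Module.finrank ℚ K = 2 ∧
      ∃ C : VariableChange ℚ, C • W.quadraticTwist (NumberField.discr K : ℚ) = Wd := by
  obtain ⟨c, t, hc, ht, het⟩ := Rat.exists_sq_mul_squarefree he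
  obtain ⟨C₃, hC₃⟩ := hWd
  obtain ⟨C₆, hC₆⟩ := W.exists_variableChange_quadraticTwist_mul_sq (t : ℚ) c hc
  have hWt : (C₃ * C₆) • W.quadraticTwist (t : ℚ) = Wd := by
    rw [mul_smul, hC₆, ← hC₃, het, mul_comm]
  have ht1 : t ≠ 1 := by
    rintro rfl
    apply hne
    obtain ⟨C₄, hC₄⟩ := W.exists_variableChange_quadraticTwist_one
    rw [Int.cast_one] at hWt
    exact ⟨C₃ * C₆ * C₄, by rw [mul_smul, hC₄]; exact hWt⟩
  obtain ⟨K, iF, iN, h2, hdisc⟩ := exists_quadraticField_of_squarefree ht ht1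
  refine ⟨K, iF, iN, h2, ?_⟩
  rcases hdisc with hK | hK
  · exact ⟨C₃ * C₆, by rw [hK]; exact hWt⟩
  · obtain ⟨C₇, hC₇⟩ := W.exists_variableChange_quadraticTwist_mul_sq (t : ℚ) 2 two_ne_zero
    refine ⟨C₃ * C₆ * C₇⁻¹, ?_⟩
    have h4t : (((4 * t : ℤ)) : ℚ) = (t : ℚ) * 2 ^ 2 := by push_cast; ring
    rw [hK, h4t, ← hC₇, mul_smul, inv_smul_smul, hWt]

/-- **`q`-adic adjustment of a twisting parameter.** For a square-free integer `m ≠ 0`, a prime `q`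
and a prime `p ≠ q` there is an integer `x ≠ 0` with `p ∤ x` such that `m x` is a square in `ℚ_q`:
with `k = q` (`q` odd) resp. `k = 8` (`q = 2`), take `x = m + k j`, resp. `x = q (m/q + k j)` when
`q ∣ m`, with `j ∈ {1, p}` chosen so that `p ∤ x`; then `m x = b (b + k j) · (1 or q²)` with `q ∤ b`,
and `b (b + k j) ≡ b²` (mod `q`, resp. mod `8`) is a `q`-adic square (Hensel; Serre, *Cours
d'arithmétique* II.3.3; tree `padic_isSquare_intCast_of_isSquare_zmod`,
`padic_isSquare_intCast_of_mod_eight`). [folklore] -/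
theorem exists_mul_isSquare_padic_not_dvd {m : ℤ} (hm0 : m ≠ 0) (hm : Squarefree m) {q : ℕ}
    [Fact q.Prime] {p : ℕ} (hp : p.Prime) (hpq : p ≠ q) :
    ∃ x : ℤ, x ≠ 0 ∧ ¬ (p : ℤ) ∣ x ∧ IsSquare (((m * x : ℤ) : ℚ) : ℚ_[q]) := by
  have hq : q.Prime := Fact.out
  have hqZ : Prime (q : ℤ) := Nat.prime_iff_prime_int.mp hq
  have hpZ : Prime (p : ℤ) := Nat.prime_iff_prime_int.mp hp
  have hpq' : ¬ (p : ℤ) ∣ q := fun h ↦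
    hpq ((Nat.prime_dvd_prime_iff_eq hp hq).mp (Int.natCast_dvd_natCast.mp h))
  -- the modulus of the congruence: `q` for odd `q`, `8` for `q = 2`; prime to `p`, divisible by `q`
  set k : ℤ := if q = 2 then 8 else q with hk_def
  have hpk : ¬ (p : ℤ) ∣ k := by
    intro h
    by_cases hq2 : q = 2
    · rw [hk_def, if_pos hq2] at h
      have h8 : (p : ℤ) ∣ 2 ^ 3 := by norm_num; exact h
      have h2 := hpZ.dvd_of_dvd_pow h8
      exact hpq' (by rw [hq2]; exact_mod_cast h2)
    · rw [hk_def, if_neg hq2] at h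
      exact hpq' h
  have hqk : (q : ℤ) ∣ k := by
    by_cases hq2 : q = 2
    · rw [hk_def, if_pos hq2, hq2]; norm_num
    · rw [hk_def, if_neg hq2]
  -- a `j ∈ {1, p}` making `a + k j` prime to `p`
  have hj : ∀ a : ℤ, ∃ j : ℤ, ¬ (p : ℤ) ∣ a + k * j := by
    intro a
    by_cases hpa : (p : ℤ) ∣ a
    · refine ⟨1, fun h ↦ hpk ?_⟩
      have : (p : ℤ) ∣ a + k * 1 - a := dvd_sub h hpa
      simpa using this
    · refine ⟨p, fun h ↦ hpa ?_⟩
      have : (p : ℤ) ∣ a + k * p - k * p := dvd_sub h (dvd_mul_left _ _)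
      simpa using this
  -- Hensel: `b (b + k j)` is a `q`-adic square when `q ∤ b`
  have hsqr : ∀ b j : ℤ, ¬ (q : ℤ) ∣ b → IsSquare (((b * (b + k * j) : ℤ)) : ℚ_[q]) := by
    intro b j hb
    by_cases hq2 : q = 2
    · have hk8 : k = 8 := by rw [hk_def, if_pos hq2]
      have hb2 : ¬ (2 : ℤ) ∣ b := by rw [hq2] at hb; exact_mod_cast hb
      have hb8 : b % 8 = 1 ∨ b % 8 = 3 ∨ b % 8 = 5 ∨ b % 8 = 7 := by omega
      have hx8 : (b + k * j) % 8 = b % 8 := by rw [hk8]; omega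
      have h1 : (b * (b + k * j)) % 8 = 1 := by
        rw [Int.mul_emod, hx8]
        rcases hb8 with h | h | h | h <;> rw [h] <;> norm_num
      exact Literature.NumberTheory.QuadraticForms.padic_isSquare_intCast_of_mod_eight hq2 h1
    · have hk' : k = q := by rw [hk_def, if_neg hq2]
      have hqy : ¬ (q : ℤ) ∣ b * (b + k * j) := by
        intro h
        rcases hqZ.dvd_or_dvd h with h1 | h1
        · exact hb h1
        · apply hb
          have : (q : ℤ) ∣ b + k * j - k * j := dvd_sub h1 (by rw [hk']; exact dvd_mul_right _ _)
          simpa using this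
      have hzm : IsSquare (((b * (b + k * j) : ℤ)) : ZMod q) := by
        refine ⟨(b : ZMod q), ?_⟩
        have hk0 : ((k : ℤ) : ZMod q) = 0 := (ZMod.intCast_zmod_eq_zero_iff_dvd k q).mpr hqk
        push_cast
        rw [hk0]
        ring
      exact Literature.NumberTheory.QuadraticForms.padic_isSquare_intCast_of_isSquare_zmod hq2 hqy hzm
  by_cases hqm : (q : ℤ) ∣ m
  · -- `m = q m₁`, `q ∤ m₁`; `x = q (m₁ + k j)`
    obtain ⟨m₁, rfl⟩ := hqm
    have hqm₁ : ¬ (q : ℤ) ∣ m₁ := fun h ↦ hqZ.not_unit (hm q (mul_dvd_mul_left _ h))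
    obtain ⟨j, hj⟩ := hj m₁
    refine ⟨q * (m₁ + k * j), ?_, ?_, ?_⟩
    · refine mul_ne_zero (by exact_mod_cast hq.ne_zero) fun h ↦ hj ?_
      rw [h]; exact dvd_zero _
    · intro h
      rcases hpZ.dvd_or_dvd h with h1 | h1
      · exact hpq' h1
      · exact hj h1
    · have hy := hsqr m₁ j hqm₁
      have hqsq : IsSquare (((q : ℤ) * q : ℤ) : ℚ_[q]) := ⟨(q : ℚ_[q]), by push_cast; ring⟩
      have h := hqsq.mul hy
      rw [show (((q * m₁ * (q * (m₁ + k * j)) : ℤ) : ℚ) : ℚ_[q]) =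
        (((q : ℤ) * q : ℤ) : ℚ_[q]) * (((m₁ * (m₁ + k * j) : ℤ)) : ℚ_[q]) by push_cast; ring]
      exact h
  · obtain ⟨j, hj⟩ := hj m
    refine ⟨m + k * j, ?_, hj, ?_⟩
    · intro h; apply hj; rw [h]; exact dvd_zero _
    · have hy := hsqr m j hqm
      rw [show (((m * (m + k * j) : ℤ) : ℚ) : ℚ_[q]) = (((m * (m + k * j) : ℤ)) : ℚ_[q]) by
        push_cast; ring]
      exact hy

/-! ### §2 X4(M): the class theorem from a `p`-multiplicative twist with a (ram) witness -/

/-- **X4(M) ⇐ the over-`K` input over quadratic fields, given a `p`-multiplicative twist with a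
(ram) witness.** Let `(E,p) ∈ X4(M)` (`W` globally minimal) have analytic rank `≤ 1`, and let `W₁`
be a globally minimal model of a quadratic twist `E^{(d₀)}` with multiplicative reduction at `p`
and at a prime `q ≠ p` with `p ∤ v_q(Δ_min(W₁))`. Suppose the typed over-`K` input
`MissingPPartOverCAt (W.baseChange K) p` holds for every quadratic field `K` whose twist `E^{(d_K)}`
is multiplicative at `p`. Then `BSD(E,p)` — Skinner 2016 Thm. C (`hSk`), Milne 1972 any-model
(`hMilneC`), GZK (`hGZK`), modularity (`hmod`, `hnf`) and Hoffstein–Luo 1997 (`hHL`) being the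
published inputs, carried as binders. Proof: twist supply with `n ≡ 1 (mod 8)`, `(n/q) = 1` for odd
`q`, `p ∤ n` (`exists_twist_L_ne_zero_of_sign`); `n` is a `q`-adic square (Hensel; at `q = 2` since
`n ≡ 1 (mod 8)`), so multiplicative reduction at `q` and `v_q(Δ_min)` transport to the globally
minimal model of `W₁^{(n)}` (x11b's `mult_iff_of_twist`, `padicValInt_minimalDiscriminantInt_eq_of_twist`),
as does multiplicative reduction at `p` (X2 owner's
`hasMultiplicativeReductionAtPrime_of_smul_eq_quadraticTwist`); then gen 2's
`bsdp_of_classX4M_of_rankZero_twist'`. X4(M) stays CONSTRUCTION-SHAPED. [folklore] -/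
theorem bsdp_of_classX4M_of_mult_ram_twist [W.IsGloballyMinimal]
    (hGZK : rank_eq_analyticRank_of_analyticRank_le_one) (hmod : hasEntireLFunction_rat)
    (hMilneC : Milne1972.bsdQuotient_baseChange_quadratic_anyModel)
    (hSk : Skinner2016.thmC_padicValRat_bsd_rank_zero)
    (hnf : exists_isNewformOf) (hHL : HoffsteinLuo1997_exists_twist_L_one_ne_zero)
    (hX : ClassX4M W p) (hr : W.analyticRank ≤ 1)
    {d₀ : ℚ} (hd₀ : d₀ ≠ 0) (W₁ : WeierstrassCurve ℚ) [W₁.IsElliptic] [W₁.IsGloballyMinimal]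
    (hW₁ : ∃ C : VariableChange ℚ, C • W.quadraticTwist d₀ = W₁) (hmult₁ : Mult W₁ p)
    {q : ℕ} [Fact q.Prime] (hqp : q ≠ p) (hmultq : Mult W₁ q)
    (hvq : ¬ p ∣ padicValInt q W₁.minimalDiscriminantInt)
    (hK : ∀ (K : Type) [Field K] [NumberField K] (Wd : WeierstrassCurve ℚ) [Wd.IsElliptic]
      [Wd.IsGloballyMinimal], Module.finrank ℚ K = 2 →
      (∃ C : VariableChange ℚ, C • W.quadraticTwist (NumberField.discr K : ℚ) = Wd) →
      Mult Wd p → MissingPPartOverCAt (W.baseChange K) p) :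
    BSDp W p := by
  have hp : p.Prime := Fact.out
  have hq : q.Prime := Fact.out
  have hp2 : p ≠ 2 := hX.p_ne_two
  -- `p ‖ N_{W₁}`
  have hpN : p ∣ W₁.conductorNorm ℤ := dvd_conductorNorm_of_mult W₁ hmult₁
  have hpN2 : ¬ p ^ 2 ∣ W₁.conductorNorm ℤ := not_sq_dvd_conductorNorm_of_mult' W₁ hmult₁
  -- twist supply, split at `q`
  obtain ⟨n, -, hn8, -, hnsign, hpn, hjac, hL⟩ :=
    exists_twist_L_ne_zero_of_sign hnf hHL W₁ hp hp2 hpN hpN2 {q} (s := 1) (Or.inl rfl) 0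
  have hn0 : 0 < n := Int.sign_eq_one_iff_pos.mp hnsign
  have hnQ : ((n : ℤ) : ℚ) ≠ 0 := by exact_mod_cast hn0.ne'
  have hnsq : IsSquare ((((n : ℤ) : ℚ) : ℚ) : ℚ_[q]) := by
    by_cases hq2 : q = 2
    · have h := Literature.NumberTheory.QuadraticForms.padic_isSquare_intCast_of_mod_eight
        (p := q) hq2 hn8
      simpa using h
    · have hnq : jacobiSym n q = 1 := hjac q (Finset.mem_singleton_self q) hq hq2 hqp
      have h := padic_isSquare_of_jacobiSym_eq_one hq2 hnq
      simpa using h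
  -- the globally minimal model `Wd` of `W₁^{(n)}`
  haveI := W₁.isElliptic_quadraticTwist hnQ
  obtain ⟨Wd, iWd, iWdm, C₂, hC₂⟩ := exists_globallyMinimal_model_twist W₁ hnQ
  have hC₂' : C₂⁻¹ • Wd = W₁.quadraticTwist ((n : ℤ) : ℚ) := by rw [← hC₂, inv_smul_smul]
  have hmultd : Mult Wd p :=
    X2.hasMultiplicativeReductionAtPrime_of_smul_eq_quadraticTwist W₁ Wd hC₂' p hp2 hpn hmult₁
  have hr0 : Wd.analyticRank = 0 := by
    rw [← hC₂, analyticRank_smul]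
    exact analyticRank_eq_zero_of_entireLFunction_one_ne_zero _ hL
  have hmultdq : Mult Wd q := (X11b.mult_iff_of_twist W₁ hnQ hnsq Wd hC₂).mpr hmultq
  have hvdq : ¬ p ∣ padicValInt q Wd.minimalDiscriminantInt := by
    rwa [X11b.padicValInt_minimalDiscriminantInt_eq_of_twist W₁ hnQ hnsq Wd hC₂]
  have hram : Ram Wd p := ⟨q, inferInstance, hqp, hmultdq, hvdq⟩
  -- `Wd` is a model of `W^{(d₀ n)}`, not of `W` (it is multiplicative at `p`, `W` is additive)
  obtain ⟨C₁, hC₁⟩ := hW₁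
  have hmodel : ∃ C : VariableChange ℚ, C • W.quadraticTwist (d₀ * ((n : ℤ) : ℚ)) = Wd := by
    refine ⟨C₂ * ⟨C₁.u, ((n : ℤ) : ℚ) * C₁.r, 0, 0⟩, ?_⟩
    rw [mul_smul, ← quadraticTwist_quadraticTwist, ← quadraticTwist_smul, hC₁, hC₂]
  have hne : ¬ ∃ C : VariableChange ℚ, C • W = Wd := by
    rintro ⟨C, hC⟩
    apply hX.potMult.not_mult
    rw [← hC] at hmultd
    exact (hasMultiplicativeReductionAtPrime_smul_iff W C p).mp hmultd
  obtain ⟨K, iF, iN, h2, hWd⟩ := exists_quadraticField_model W (mul_ne_zero hd₀ hnQ) hmodel hne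
  exact bsdp_of_classX4M_of_rankZero_twist' W p K Wd hGZK hmod hMilneC hSk hX hr h2 hWd hmultd hram
    hr0 (hK K Wd h2 hWd hmultd)

/-! ### §3 X4(M) ∧ (ram): `E` itself has a (ram) witness -/

/-- **X4(M) ∧ ram(E,p) ⇐ the over-`K` input over quadratic fields — uniformly, no census datum.**
Let `(E,p) ∈ X4(M)` (`W` globally minimal) have analytic rank `≤ 1` and satisfy `Ram W p` (a prime
`q ≠ p` of multiplicative reduction with `p ∤ v_q(Δ_min(E))`, the hypothesis (ram) of Skinner–Urban
/ Skinner 2016 read on `E`). If `MissingPPartOverCAt (W.baseChange K) p` holds for every quadratic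
field `K` whose twist `E^{(d_K)}` is multiplicative at `p`, then `BSD(E,p)` (binders as in
`bsdp_of_classX4M_of_mult_ram_twist`). Proof: `E` is potentially multiplicative at `p`, so some
`E^{(d)}` is `p`-multiplicative (`PotMult.exists_twist_mult`, Silverman *ATAEC* V.5.3); replacing
`d` by its square-free part `m` and then by `m x` with `x` the `q`-adic adjustment of
`exists_mul_isSquare_padic_not_dvd` (`p ∤ x`, `m x` a `q`-adic square) keeps multiplicative
reduction at `p` (X2 owner's lemma) and makes the twist `q`-adically isomorphic to `E`, so `q` and
`v_q(Δ_min)` transport (x11b's lemmas); conclude by `bsdp_of_classX4M_of_mult_ram_twist`.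
X4(M) stays CONSTRUCTION-SHAPED. [folklore] -/
theorem bsdp_of_classX4M_of_ram [W.IsGloballyMinimal]
    (hGZK : rank_eq_analyticRank_of_analyticRank_le_one) (hmod : hasEntireLFunction_rat)
    (hMilneC : Milne1972.bsdQuotient_baseChange_quadratic_anyModel)
    (hSk : Skinner2016.thmC_padicValRat_bsd_rank_zero)
    (hnf : exists_isNewformOf) (hHL : HoffsteinLuo1997_exists_twist_L_one_ne_zero)
    (hX : ClassX4M W p) (hr : W.analyticRank ≤ 1) (hram : Ram W p)
    (hK : ∀ (K : Type) [Field K] [NumberField K] (Wd : WeierstrassCurve ℚ) [Wd.IsElliptic]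
      [Wd.IsGloballyMinimal], Module.finrank ℚ K = 2 →
      (∃ C : VariableChange ℚ, C • W.quadraticTwist (NumberField.discr K : ℚ) = Wd) →
      Mult Wd p → MissingPPartOverCAt (W.baseChange K) p) :
    BSDp W p := by
  have hp : p.Prime := Fact.out
  have hp2 : p ≠ 2 := hX.p_ne_two
  obtain ⟨q, iq, hqp, hmultq, hvq⟩ := hram
  -- a `p`-multiplicative twist with square-free integral parameter `m`
  obtain ⟨d, hd0, hmultd⟩ := PotMult.exists_twist_mult (W := W) (p := p) hX.potMult
  obtain ⟨c, m, hc, hm, hdm⟩ := Rat.exists_sq_mul_squarefree hd0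
  have hm0 : m ≠ 0 := by
    rintro rfl
    apply hd0
    rw [hdm]; simp
  have hmQ : (m : ℚ) ≠ 0 := by exact_mod_cast hm0
  obtain ⟨W₀, iW₀, iW₀m, C₀, hC₀⟩ := exists_globallyMinimal_model_twist W hmQ
  have hmult₀ : Mult W₀ p := by
    -- `W₀ ≅ W^{(m)} ≅ W^{(m c²)} = W^{(d)}`
    obtain ⟨C₅, hC₅⟩ := W.exists_variableChange_quadraticTwist_mul_sq (m : ℚ) c hc
    have hWd : (C₀ * C₅⁻¹) • W.quadraticTwist d = W₀ := by
      rw [hdm, mul_comm, ← hC₅, mul_smul, inv_smul_smul, hC₀]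
    exact mult_of_model_twist hd0 hmultd ⟨C₀ * C₅⁻¹, hWd⟩
  -- the `q`-adic adjustment `x`
  obtain ⟨x, hx0, hpx, hsq⟩ := exists_mul_isSquare_padic_not_dvd hm0 hm (q := q) hp (Ne.symm hqp)
  have hxQ : ((x : ℤ) : ℚ) ≠ 0 := by exact_mod_cast hx0
  haveI := W₀.isElliptic_quadraticTwist hxQ
  obtain ⟨W₁, iW₁, iW₁m, C₁, hC₁⟩ := exists_globallyMinimal_model_twist W₀ hxQ
  have hC₁' : C₁⁻¹ • W₁ = W₀.quadraticTwist ((x : ℤ) : ℚ) := by rw [← hC₁, inv_smul_smul]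
  have hmult₁ : Mult W₁ p :=
    X2.hasMultiplicativeReductionAtPrime_of_smul_eq_quadraticTwist W₀ W₁ hC₁' p hp2 hpx hmult₀
  -- `W₁` is a model of `W^{(m x)}`, a `q`-adic square twist of `W`
  have hmx0 : ((m * x : ℤ) : ℚ) ≠ 0 := by exact_mod_cast mul_ne_zero hm0 hx0
  have hW₁ : ∃ C : VariableChange ℚ, C • W.quadraticTwist ((m * x : ℤ) : ℚ) = W₁ := by
    refine ⟨C₁ * ⟨C₀.u, ((x : ℤ) : ℚ) * C₀.r, 0, 0⟩, ?_⟩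
    rw [Int.cast_mul, mul_smul, ← quadraticTwist_quadraticTwist, ← quadraticTwist_smul, hC₀, hC₁]
  obtain ⟨C, hC⟩ := hW₁
  have hmultq₁ : Mult W₁ q := (X11b.mult_iff_of_twist W hmx0 hsq W₁ hC).mpr hmultq
  have hvq₁ : ¬ p ∣ padicValInt q W₁.minimalDiscriminantInt := by
    rwa [X11b.padicValInt_minimalDiscriminantInt_eq_of_twist W hmx0 hsq W₁ hC]
  exact bsdp_of_classX4M_of_mult_ram_twist hGZK hmod hMilneC hSk hnf hHL hX hr hmx0 W₁ ⟨C, hC⟩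
    hmult₁ hqp hmultq₁ hvq₁ hK

/-- **The same with the plainer hypothesis** "the `p`-part of BSD for `E` over every quadratic
field": for `(E,p) ∈ X4(M)` of analytic rank `≤ 1` with `Ram W p`,
`(∀ K quadratic, MissingPPartOverCAt (W.baseChange K) p) → BSDp W p`. [folklore] -/
theorem bsdp_of_classX4M_of_ram_of_forall_quadratic [W.IsGloballyMinimal]
    (hGZK : rank_eq_analyticRank_of_analyticRank_le_one) (hmod : hasEntireLFunction_rat)
    (hMilneC : Milne1972.bsdQuotient_baseChange_quadratic_anyModel)
    (hSk : Skinner2016.thmC_padicValRat_bsd_rank_zero)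
    (hnf : exists_isNewformOf) (hHL : HoffsteinLuo1997_exists_twist_L_one_ne_zero)
    (hX : ClassX4M W p) (hr : W.analyticRank ≤ 1) (hram : Ram W p)
    (hK : ∀ (K : Type) [Field K] [NumberField K], Module.finrank ℚ K = 2 →
      MissingPPartOverCAt (W.baseChange K) p) :
    BSDp W p :=
  bsdp_of_classX4M_of_ram hGZK hmod hMilneC hSk hnf hHL hX hr hram fun K _ _ _ _ _ h2 _ _ ↦ hK K h2

/-- The X4(M) ∧ (ram) theorem in the cell's `MissingPPartAt` currency (Partition / additive-p4's
`X4Sharp` bookkeeping). [folklore] -/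
theorem missingPPartAt_of_classX4M_of_ram [W.IsGloballyMinimal]
    (hGZK : rank_eq_analyticRank_of_analyticRank_le_one) (hmod : hasEntireLFunction_rat)
    (hMilneC : Milne1972.bsdQuotient_baseChange_quadratic_anyModel)
    (hSk : Skinner2016.thmC_padicValRat_bsd_rank_zero)
    (hnf : exists_isNewformOf) (hHL : HoffsteinLuo1997_exists_twist_L_one_ne_zero)
    (hX : ClassX4M W p) (hr : W.analyticRank ≤ 1) (hram : Ram W p)
    (hK : ∀ (K : Type) [Field K] [NumberField K] (Wd : WeierstrassCurve ℚ) [Wd.IsElliptic]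
      [Wd.IsGloballyMinimal], Module.finrank ℚ K = 2 →
      (∃ C : VariableChange ℚ, C • W.quadraticTwist (NumberField.discr K : ℚ) = Wd) →
      Mult Wd p → MissingPPartOverCAt (W.baseChange K) p) :
    MissingPPartAt W p := by
  haveI : Finite W.sha := (hGZK W hr).2
  exact missingPPartAt_of_bsdp W p (bsdp_of_classX4M_of_ram hGZK hmod hMilneC hSk hnf hHL hX hr hram hK)

end Summit.BirchSwinnertonDyer.Rank1Residual.AdditivePotMult

end
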